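import Summits.BirchSwinnertonDyer.Rank1Residual.Additive.PotSupersingularNotCotorsion
import Literature.NumberTheory.DiophantineGeometry.ConductorExponentLeFiveProofs
import Literature.NumberTheory.DiophantineGeometry.TateAlgorithmLocal
import HarnessLib

/-!
# The Kummer–Tate good model of a KODAIRA DIVISIBILITY PROFILE over `𝒪_v`, scaled by a Kummer
# element of `K̄_v` — row T-CG-SS addendum A3, file A3a-1 (cell `b2b-bsdres`, team n1011; seat n1011-p05 gen 8)

HONEST FRAMING (cell `b2b-bsdres`, run/shared/lean/b2b/bsd-rank1-residual/, verbatim in every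
file): the goal of the cell is to DELETE the COMBINATION-SHAPED residual classes of the
Birch–Swinnerton-Dyer formula for ALL analytic-rank `≤ 1` elliptic curves over `ℚ` — "full BSD
formula for every rank `≤ 1` curve in class `C`" assembled STRICTLY from published theorems — so
that the rank-`≤ 1` remainder becomes exactly the CONSTRUCTION-SHAPED classes, which are TYPED
(missing-input `Prop`s), NOT attempted. This is not "finishing BSD". Team n1011 (X4 ∧ `p = 3`,
§I N10/N11; here in the service of the O5 cell O5b = `(t′)@3`): research route; TOOL theorems only;
no definition, no named fact; census = EVIDENCE; nothing booked; no mark moved.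

## What and why

p07's Kummer–Deuring good model (`KummerDeuringModel(Global)`: `W₀ = ⟨u, 0, 0, 0⟩ · (short normal
form over ℚ)`, `u^e = p^m`) needs `2, 3 ∈ 𝒪_w^×`, i.e. `p ≥ 5`. This file gives the replacement that
works at EVERY `p`, in particular at `p = 3`: start from ANY Weierstrass equation `V` over
`𝒪_v = v.adicCompletionIntegers ℚ` and ANY `𝒪_v`-change of variables `D` bringing it to a
"Kodaira divisibility profile" `(D • V).a_i ∈ 𝔪_v^{k_i}` (`i = 1, 2, 3, 4, 6`),
`Δ(D • V) = (unit)·p^n` — Tate's normal forms (the tree's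
`exists_smul_of_kodairaSymbolOfMinimal_eq_III / _IIIstar`, …) are exactly such data — and scale by
`u = θ'^j` for a Kummer element `θ' ∈ K̄_v`, `θ'^e = p`: when `i·j ≤ e·k_i` and `e·n = 12·j` the
scaled equation `W₀ = ⟨u, 0, 0, 0⟩ • (D • V) ⊗ K̄_v` has coefficients in the valuation ring `𝒪_w` of
the spectral valuation (`|a_i / u^i|_w ≤ 1`) and UNIT discriminant (`|Δ|_w = |u|^{12}`), and the
total change of variables `C = ⟨u, 0, 0, 0⟩ · D` is fixed by every `K_v`-automorphism of `K̄_v`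
fixing `θ'` (the entries of `D` lie in `K_v`).

* §1 valuation bookkeeping along `𝒪_v → K_v → K̄_v` for `|·|_w = specVal v`: integers have
  `|·| ≤ 1` (`specVal_algebraMap_adicCompletionIntegers_le_one`), units `|·| = 1`
  (`…_eq_one_of_isUnit`), `|p| < 1` (`specVal_natCast_lt_one`), and `𝔪_v^k` has `|·| ≤ |p|^k`
  (`specVal_algebraMap_le_pow_of_mem_maximalIdeal_pow`; `p` is a uniformiser of `𝒪_v`, the tree's
  `Rat.irreducible_natCast_natGenerator`).
* §2 **`exists_goodModel_of_kodairaProfile`** — the scaled model, its unit discriminant and the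
  fixedness of `C`, for an arbitrary profile (Silverman *AEC* VII.5.5 made explicit through Tate's
  normal forms; Serre 1972 §5.6: the semistability defect is the order of the Kummer scaling).

Consumer: file A3a-2 `GoodModelTameThree.lean` (profiles `III`: `k = (1,1,1,1,2)`, `n = 3`,
`e = 4`, `j = 1`; `III*`: `k = (1,2,3,3,5)`, `n = 9`, `e = 4`, `j = 3`, at `p = 3`).

References: J. H. Silverman, *AEC* VII.1.3, VII.5.5 [SilvermanAEC2009]; J.-P. Serre, Invent. Math.
15 (1972) §5.6 [Serre1972]; J. Tate, *Algorithm for determining the type of a singular fiber* (1975)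
§§7–8 [Tate1975]; cells/n1011/skel/T-CG-SS-A3.md (4ee65abe034abfbf).
-/

noncomputable section

open scoped Classical NNReal NumberField

open WeierstrassCurve

universe u

namespace Summit.BirchSwinnertonDyer.Rank1Residual.Additive.GoodModelLine

open NumberField IsDedekindDomain Field IsDedekindDomain.HeightOneSpectrum IsLocalRing
  Literature.NumberTheory.GaloisRepresentations Literature.NumberTheory.EllipticCurves
  Literature.NumberTheory.EllipticCurves.Rank1Residual
  Literature.NumberTheory.DiophantineGeometry
  Summit.BirchSwinnertonDyer.Rank1Residual.X2.GreenbergVatsalReductionDatum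

variable (p : ℕ) [hp : Fact p.Prime] {v : HeightOneSpectrum (𝓞 ℚ)}

/-! ## §1 The spectral valuation on the image of `𝒪_v` -/

section Valuation

omit hp in
/-- `|y|_w ≤ 1` for `y ∈ 𝒪_v` (the spectral norm extends `|·|_v`). [folklore] -/
theorem specVal_algebraMap_adicCompletionIntegers_le_one (y : v.adicCompletionIntegers ℚ) :
    specVal v (algebraMap (v.adicCompletion ℚ) (AlgebraicClosure (v.adicCompletion ℚ))
      (y : v.adicCompletion ℚ)) ≤ 1 :=
  (spectralValuation_algebraMap_le_one_iff (specVal_spec v) (y : v.adicCompletion ℚ)).mpr y.2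

omit hp in
/-- `|y|_w = 1` for a unit `y ∈ 𝒪_v^×`. [folklore] -/
theorem specVal_algebraMap_adicCompletionIntegers_eq_one_of_isUnit {y : v.adicCompletionIntegers ℚ}
    (hy : IsUnit y) :
    specVal v (algebraMap (v.adicCompletion ℚ) (AlgebraicClosure (v.adicCompletion ℚ))
      (y : v.adicCompletion ℚ)) = 1 := by
  obtain ⟨u, rfl⟩ := hy
  set L := AlgebraicClosure (v.adicCompletion ℚ)
  have h1 := specVal_algebraMap_adicCompletionIntegers_le_one (v := v) (u : v.adicCompletionIntegers ℚ)
  have h2 := specVal_algebraMap_adicCompletionIntegers_le_one (v := v)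
    (↑u⁻¹ : v.adicCompletionIntegers ℚ)
  have hmul : specVal v (algebraMap (v.adicCompletion ℚ) L
        ((u : v.adicCompletionIntegers ℚ) : v.adicCompletion ℚ)) *
      specVal v (algebraMap (v.adicCompletion ℚ) L
        ((↑u⁻¹ : v.adicCompletionIntegers ℚ) : v.adicCompletion ℚ)) = 1 := by
    rw [← map_mul, ← map_mul, ← Subring.coe_mul, Units.mul_inv, Subring.coe_one, map_one, map_one]
  refine le_antisymm h1 ?_
  by_contra hlt
  rw [not_le] at hlt
  exact (mul_lt_one_of_nonneg_of_lt_one_left (by positivity) hlt h2).ne hmul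

omit hp in
/-- `|p|_w < 1` at `v ∋ p`. [folklore] -/
theorem specVal_natCast_lt_one (hpv : ((p : ℕ) : 𝓞 ℚ) ∈ v.asIdeal) :
    specVal v ((p : ℕ) : AlgebraicClosure (v.adicCompletion ℚ)) < 1 := by
  have h := spectralValuation_algebraMap_ringOfIntegers_lt_one (v := v) (specVal_spec v) hpv
  rwa [map_natCast] at h

/-- `|y|_w ≤ |p|^k` for `y ∈ 𝔪_v^k` (`p` is a uniformiser of `𝒪_v` at `v ∋ p`). [folklore] -/
theorem specVal_algebraMap_le_pow_of_mem_maximalIdeal_pow (hpv : ((p : ℕ) : 𝓞 ℚ) ∈ v.asIdeal)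
    {y : v.adicCompletionIntegers ℚ} {k : ℕ} (hy : y ∈ maximalIdeal (v.adicCompletionIntegers ℚ) ^ k) :
    specVal v (algebraMap (v.adicCompletion ℚ) (AlgebraicClosure (v.adicCompletion ℚ))
      (y : v.adicCompletion ℚ)) ≤
      specVal v ((p : ℕ) : AlgebraicClosure (v.adicCompletion ℚ)) ^ k := by
  have hgen : Rat.HeightOneSpectrum.natGenerator v = p :=
    Rat.HeightOneSpectrum.natGenerator_eq_of_natCast_mem v hp.out hpv
  have hirr : Irreducible ((p : ℕ) : v.adicCompletionIntegers ℚ) := by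
    rw [← hgen]; exact Rat.irreducible_natCast_natGenerator v
  obtain ⟨z, hz⟩ := (TateAlgorithm.mem_maximalIdeal_pow_iff_dvd_of_irreducible hirr y k).mp hy
  rw [hz, Subring.coe_mul, Subring.coe_pow, map_mul, map_pow, map_mul, map_pow]
  have hcoe : (((p : ℕ) : v.adicCompletionIntegers ℚ) : v.adicCompletion ℚ) = (p : ℕ) := rfl
  rw [hcoe, map_natCast]
  exact mul_le_of_le_one_right (by positivity) (specVal_algebraMap_adicCompletionIntegers_le_one z)

end Valuation

/-! ## §2 The scaled good model for a Kodaira divisibility profile -/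

section Profile

/-- **The Kummer–Tate good model for a divisibility profile.** Let `V` be a Weierstrass equation over
`𝒪_v` (`v ∋ p`), `D` an `𝒪_v`-change of variables with `(D • V).a_i ∈ 𝔪_v^{k_i}` (`i = 1,2,3,4,6`)
and `Δ(D • V) = (unit)·p^n`; let `θ' ∈ K̄_v` with `θ'^e = p` (`e ≠ 0`) and `j` with `i·j ≤ e·k_i`,
`e·n = 12·j`. Then `W₀ = ⟨θ'^j, 0, 0, 0⟩ • (D • V) ⊗ K̄_v` has coefficients in `𝒪_w` and UNIT
discriminant, `C • (V ⊗ K_v) ⊗ K̄_v = W₀ ⊗ K̄_v` for `C = ⟨θ'^j, 0, 0, 0⟩ · D`, and `C` is fixed by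
every `K_v`-automorphism of `K̄_v` fixing `θ'` (Silverman *AEC* VII.5.5 made explicit through Tate's
normal forms; Serre 1972 §5.6). [cite: SilvermanAEC2009, Prop. VII.5.5] [cite: Serre1972, §5.6 (p. 312)] -/
theorem exists_goodModel_of_kodairaProfile (hpv : ((p : ℕ) : 𝓞 ℚ) ∈ v.asIdeal)
    (V : WeierstrassCurve (v.adicCompletionIntegers ℚ))
    (D : VariableChange (v.adicCompletionIntegers ℚ)) {k₁ k₂ k₃ k₄ k₆ n e j : ℕ} (he : e ≠ 0)
    (h₁ : (D • V).a₁ ∈ maximalIdeal (v.adicCompletionIntegers ℚ) ^ k₁)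
    (h₂ : (D • V).a₂ ∈ maximalIdeal (v.adicCompletionIntegers ℚ) ^ k₂)
    (h₃ : (D • V).a₃ ∈ maximalIdeal (v.adicCompletionIntegers ℚ) ^ k₃)
    (h₄ : (D • V).a₄ ∈ maximalIdeal (v.adicCompletionIntegers ℚ) ^ k₄)
    (h₆ : (D • V).a₆ ∈ maximalIdeal (v.adicCompletionIntegers ℚ) ^ k₆)
    (hΔ : ∃ w₀ : (v.adicCompletionIntegers ℚ)ˣ,
      (D • V).Δ = w₀ * ((p : ℕ) : v.adicCompletionIntegers ℚ) ^ n)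
    (hk₁ : 1 * j ≤ e * k₁) (hk₂ : 2 * j ≤ e * k₂) (hk₃ : 3 * j ≤ e * k₃) (hk₄ : 4 * j ≤ e * k₄)
    (hk₆ : 6 * j ≤ e * k₆) (hn : e * n = 12 * j)
    {θ' : AlgebraicClosure (v.adicCompletion ℚ)}
    (hθ' : θ' ^ e = ((p : ℕ) : AlgebraicClosure (v.adicCompletion ℚ))) :
    ∃ (C : VariableChange (AlgebraicClosure (v.adicCompletion ℚ)))
      (W₀ : WeierstrassCurve (specVal v).integer),
      C • (V.map (algebraMap (v.adicCompletionIntegers ℚ) (v.adicCompletion ℚ))).baseChange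
          (AlgebraicClosure (v.adicCompletion ℚ)) =
        W₀.baseChange (AlgebraicClosure (v.adicCompletion ℚ)) ∧ IsUnit W₀.Δ ∧
      ∀ ψ : AlgebraicClosure (v.adicCompletion ℚ) ≃ₐ[v.adicCompletion ℚ]
          AlgebraicClosure (v.adicCompletion ℚ), ψ θ' = θ' →
        C.map (ψ : AlgebraicClosure (v.adicCompletion ℚ) →+* AlgebraicClosure (v.adicCompletion ℚ)) = C := by
  haveI : CharZero (AlgebraicClosure (v.adicCompletion ℚ)) :=
    charZero_of_injective_algebraMap (algebraMap ℚ (AlgebraicClosure (v.adicCompletion ℚ))).injective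
  set w := specVal v with hw
  set φ : (v.adicCompletionIntegers ℚ) →+* (AlgebraicClosure (v.adicCompletion ℚ)) := (algebraMap (v.adicCompletion ℚ) (AlgebraicClosure (v.adicCompletion ℚ))).comp (algebraMap (v.adicCompletionIntegers ℚ) (v.adicCompletion ℚ)) with hφ
  have hvO : w.Integers w.integer := Valuation.integer.integers _
  have hφapply : ∀ y : (v.adicCompletionIntegers ℚ), φ y = algebraMap (v.adicCompletion ℚ) (AlgebraicClosure (v.adicCompletion ℚ)) (y : v.adicCompletion ℚ) := fun _ ↦ rfl
  set J := D • V with hJ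
  -- valuations: `q = |p| < 1`, `t = |θ'|`, `t^e = q`, `t ≤ 1`
  set q : ℝ≥0 := w ((p : ℕ) : (AlgebraicClosure (v.adicCompletion ℚ))) with hq
  have hq1 : q < 1 := specVal_natCast_lt_one p hpv
  set t : ℝ≥0 := w θ' with ht
  have hte : t ^ e = q := by rw [ht, ← map_pow, hθ', hq]
  have ht1 : t ≤ 1 := by
    by_contra h
    rw [not_le] at h
    have : 1 < t ^ e := one_lt_pow₀ h he
    rw [hte] at this
    exact absurd (hq1.trans this) (lt_irrefl _)
  have hp0 : ((p : ℕ) : (AlgebraicClosure (v.adicCompletion ℚ))) ≠ 0 := Nat.cast_ne_zero.mpr hp.out.ne_zero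
  have hθ0 : θ' ≠ 0 := by
    intro h0; rw [h0, zero_pow he] at hθ'; exact hp0 hθ'.symm
  set u : (AlgebraicClosure (v.adicCompletion ℚ)) := θ' ^ j with hu
  have hu0 : u ≠ 0 := pow_ne_zero j hθ0
  have hwu : w u = t ^ j := by rw [hu, map_pow, ht]
  have hwu0 : w u ≠ 0 := (Valuation.ne_zero_iff _).mpr hu0
  -- `|a_i| ≤ |u|^i`
  have hbound : ∀ {a : (v.adicCompletionIntegers ℚ)} {k i : ℕ}, a ∈ maximalIdeal (v.adicCompletionIntegers ℚ) ^ k → i * j ≤ e * k → w (φ a) ≤ w u ^ i := by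
    intro a k i ha hik
    calc w (φ a) ≤ q ^ k := specVal_algebraMap_le_pow_of_mem_maximalIdeal_pow p hpv ha
      _ = t ^ (e * k) := by rw [← hte, ← pow_mul]
      _ ≤ t ^ (i * j) := pow_le_pow_right_of_le_one' ht1 hik
      _ = w u ^ i := by rw [hwu, ← pow_mul, mul_comm]
  have hint : ∀ {a : (v.adicCompletionIntegers ℚ)} {k i : ℕ}, a ∈ maximalIdeal (v.adicCompletionIntegers ℚ) ^ k → i * j ≤ e * k → w (u⁻¹ ^ i * φ a) ≤ 1 := by
    intro a k i ha hik
    rw [map_mul, map_pow, map_inv₀]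
    calc (w u)⁻¹ ^ i * w (φ a) ≤ (w u)⁻¹ ^ i * w u ^ i := mul_le_mul' le_rfl (hbound ha hik)
      _ = 1 := by rw [← mul_pow, inv_mul_cancel₀ hwu0, one_pow]
  have hwa₁ : w (u⁻¹ ^ 1 * φ J.a₁) ≤ 1 := hint h₁ hk₁
  have hwa₂ : w (u⁻¹ ^ 2 * φ J.a₂) ≤ 1 := hint h₂ hk₂
  have hwa₃ : w (u⁻¹ ^ 3 * φ J.a₃) ≤ 1 := hint h₃ hk₃
  have hwa₄ : w (u⁻¹ ^ 4 * φ J.a₄) ≤ 1 := hint h₄ hk₄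
  have hwa₆ : w (u⁻¹ ^ 6 * φ J.a₆) ≤ 1 := hint h₆ hk₆
  -- the model
  set Cu : VariableChange (AlgebraicClosure (v.adicCompletion ℚ)) := ⟨Units.mk0 u hu0, 0, 0, 0⟩ with hCu
  set C : VariableChange (AlgebraicClosure (v.adicCompletion ℚ)) := Cu * D.map φ with hC
  set W₀ : WeierstrassCurve w.integer :=
    ⟨⟨u⁻¹ ^ 1 * φ J.a₁, hwa₁⟩, ⟨u⁻¹ ^ 2 * φ J.a₂, hwa₂⟩, ⟨u⁻¹ ^ 3 * φ J.a₃, hwa₃⟩,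
      ⟨u⁻¹ ^ 4 * φ J.a₄, hwa₄⟩, ⟨u⁻¹ ^ 6 * φ J.a₆, hwa₆⟩⟩ with hW₀
  have hX : (V.map (algebraMap (v.adicCompletionIntegers ℚ) (v.adicCompletion ℚ))).baseChange (AlgebraicClosure (v.adicCompletion ℚ)) = V.map φ := by
    rw [baseChange, map_map]
  have hCuu : ((Cu.u⁻¹ : (AlgebraicClosure (v.adicCompletion ℚ))ˣ) : (AlgebraicClosure (v.adicCompletion ℚ))) = u⁻¹ := by rw [hCu, Units.val_inv_eq_inv_val, Units.val_mk0]
  have hJφ : (D.map φ) • (V.map φ) = J.map φ := by rw [hJ, map_variableChange]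
  have hmodel : C • (V.map (algebraMap (v.adicCompletionIntegers ℚ) (v.adicCompletion ℚ))).baseChange (AlgebraicClosure (v.adicCompletion ℚ)) = W₀.baseChange (AlgebraicClosure (v.adicCompletion ℚ)) := by
    rw [hX, hC, mul_smul, hJφ]
    ext
    · rw [variableChange_a₁, hCuu]; simp [hCu, hW₀]; rfl
    · rw [variableChange_a₂, hCuu]; simp [hCu, hW₀]; rfl
    · rw [variableChange_a₃, hCuu]; simp [hCu, hW₀]; rfl
    · rw [variableChange_a₄, hCuu]; simp [hCu, hW₀]; rfl
    · rw [variableChange_a₆, hCuu]; simp [hCu, hW₀]; rfl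
  refine ⟨C, W₀, hmodel, ?_, fun ψ hψ ↦ ?_⟩
  · -- unit discriminant: `|Δ(J)| = q^n = t^{e n} = t^{12 j} = |u|^{12}`
    obtain ⟨w₀, hw₀⟩ := hΔ
    have hcoe : (((p : ℕ) : (v.adicCompletionIntegers ℚ)) : v.adicCompletion ℚ) = (p : ℕ) := rfl
    have hw₀1 : w (φ ↑w₀) = 1 := by
      rw [hφapply]; exact specVal_algebraMap_adicCompletionIntegers_eq_one_of_isUnit w₀.isUnit
    have hDu : w (φ ↑D.u) = 1 := by
      rw [hφapply]; exact specVal_algebraMap_adicCompletionIntegers_eq_one_of_isUnit D.u.isUnit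
    have hDu0 : φ ↑D.u ≠ 0 := (Valuation.ne_zero_iff w).mp (by rw [hDu]; exact one_ne_zero)
    have hφp : φ ((p : ℕ) : (v.adicCompletionIntegers ℚ)) = ((p : ℕ) : (AlgebraicClosure (v.adicCompletion ℚ))) := by rw [hφapply, hcoe, map_natCast]
    have hwΔ : w (φ J.Δ) = w u ^ 12 := by
      rw [hw₀, map_mul, map_pow, map_mul, map_pow, hw₀1, one_mul, hφp, ← hq, ← hte, ← pow_mul, hn,
        hwu, ← pow_mul, mul_comm j 12]
    have hJΔ0 : φ J.Δ ≠ 0 := by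
      rw [hw₀, map_mul, map_pow, hφp]
      exact mul_ne_zero ((Valuation.ne_zero_iff w).mp (by rw [hw₀1]; exact one_ne_zero))
        (pow_ne_zero _ hp0)
    have hVΔ : φ V.Δ = (φ ↑D.u) ^ 12 * φ J.Δ := by
      rw [hJ, variableChange_Δ, map_mul, map_pow, ← mul_assoc, ← mul_pow, ← map_mul,
        Units.mul_inv, map_one, one_pow, one_mul]
    apply hvO.isUnit_of_one
    · exact isUnit_iff_ne_zero.mpr (by
        intro h0
        have h : (W₀.baseChange (AlgebraicClosure (v.adicCompletion ℚ))).Δ = 0 := by rw [baseChange, map_Δ]; exact h0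
        rw [← hmodel, variableChange_Δ, hX, map_Δ, hVΔ] at h
        exact (mul_ne_zero (pow_ne_zero _ (Units.ne_zero _))
          (mul_ne_zero (pow_ne_zero _ hDu0) hJΔ0)) h)
    · have hCval : ((C.u⁻¹ : (AlgebraicClosure (v.adicCompletion ℚ))ˣ) : (AlgebraicClosure (v.adicCompletion ℚ))) = (φ ↑D.u)⁻¹ * u⁻¹ := by
        rw [Units.val_inv_eq_inv_val, hC, VariableChange.mul_def]
        simp [hCu, VariableChange.map]
      have h : w (W₀.baseChange (AlgebraicClosure (v.adicCompletion ℚ))).Δ = 1 := by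
        rw [← hmodel, variableChange_Δ, hX, map_Δ, hCval, hVΔ]
        simp only [map_mul, map_pow, map_inv₀]
        rw [hDu, hwΔ, inv_one, one_mul, one_pow, one_mul, ← mul_pow, inv_mul_cancel₀ hwu0, one_pow]
      rw [baseChange, map_Δ] at h
      exact h
  · -- `ψ` fixes `C`: `u = θ'^j` by hypothesis, `D` has entries in `K_v`
    have hψu : ψ u = u := by rw [hu, map_pow, hψ]
    have hψφ : (ψ : (AlgebraicClosure (v.adicCompletion ℚ)) →+* (AlgebraicClosure (v.adicCompletion ℚ))).comp φ = φ := by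
      rw [hφ, ← RingHom.comp_assoc]
      congr 1
      ext x
      exact ψ.commutes x
    have hD' : (D.map φ).map (ψ : (AlgebraicClosure (v.adicCompletion ℚ)) →+* (AlgebraicClosure (v.adicCompletion ℚ))) = D.map φ := by rw [VariableChange.map_map, hψφ]
    have hCu' : Cu.map (ψ : (AlgebraicClosure (v.adicCompletion ℚ)) →+* (AlgebraicClosure (v.adicCompletion ℚ))) = Cu := by
      rw [hCu]
      ext
      · simp [VariableChange.map, hψu]
      · simp [VariableChange.map]
      · simp [VariableChange.map]
      · simp [VariableChange.map]
    rw [hC, show (Cu * D.map φ).map (ψ : (AlgebraicClosure (v.adicCompletion ℚ)) →+* (AlgebraicClosure (v.adicCompletion ℚ))) = Cu.map (ψ : (AlgebraicClosure (v.adicCompletion ℚ)) →+* (AlgebraicClosure (v.adicCompletion ℚ))) * (D.map φ).map (ψ : (AlgebraicClosure (v.adicCompletion ℚ)) →+* (AlgebraicClosure (v.adicCompletion ℚ)))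
      from map_mul (VariableChange.mapHom (ψ : (AlgebraicClosure (v.adicCompletion ℚ)) →+* (AlgebraicClosure (v.adicCompletion ℚ)))) Cu (D.map φ), hCu', hD']

end Profile
end Summit.BirchSwinnertonDyer.Rank1Residual.Additive.GoodModelLine

end
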